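import Summits.CriticalPhenomena.SAWScalingLimit.Theses.SAWConePseudogroup
import Summits.CriticalPhenomena.SAWScalingLimit.Theorems.SubseqIdentification.Negative.ProbabilityRedundant
import Literature.Probability.RandomPlanarGeometry.SLEConvergenceCriterion
import Literature.Probability.RandomPlanarGeometry.ConformalRestrictionProofs
import HarnessLib.Audit

/-!
# Crux `PowerMapUniversality` (stmt-CriticalPhenomena-7303) — birth skeleton `Lines/birth.lean`

Route `SAWConePseudogroup` (sub-problem `SAWScalingLimit`), rank-2 crux, BY NAME:
`Summit.CriticalPhenomena.SAWScalingLimit.Theses.SAWConePseudogroup.PowerMapUniversality` —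
for every Dobrushin domain `D` with `closure D ⊆ S = {z ≠ 0, |arg z| < 3π/4}`, every Dobrushin
`D'` with carrier `Φ(D)` and marks `Φ(a), Φ(b)`, every continuous `Φ = z^{4/3}` on `S`, all endpoint
approximations `(a_δ, b_δ)` of `D` and `(a'_δ, b'_δ)` of `D'` and every bounded continuous `f` on
`CurveClass ℂ`:  `∫ f (Φ ∘ γ) d law_{D,δ} − ∫ f(γ) d law_{D',δ} → 0` as `δ → 0⁺` (the critical `δℤ²`
SAW laws in `D`, pushed by the ONE power map, and in `D' = Φ(D)` are asymptotically equal; no limit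
object appears in the crux).

## The line: precompactness + identification of the Φ-RELATION between joint subsequential limits

Billingsley's subsequence principle along the countably generated filter `𝓝[>] 0`: a real family
`u δ` tends to `0` iff every sequence `δₙ → 0⁺` has a subsequence along which it does.  Along a
sequence, PRECOMPACTNESS of the two families of curve laws (Prokhorov, past the junk meshes where the
SAW law is `0`) extracts a further subsequence with joint weak limits `ν` (of the `D`-laws) and `ν'`
(of the `D'`-laws), both probability measures; the whole content of the crux is then that EVERY such
pair is related by the power map, `ν' = (CurveClass.map Φ)_* ν` — because then
`∫ f∘(map Φ) d law_D → ∫ f d(Φ_* ν) = ∫ f dν' ← ∫ f d law_{D'}` along the subsequence.  Hence two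
registered stubs, each a genuine open lattice statement, and a kernel-checked composition:

* `stub_eventualTight` — (T) PRECOMPACTNESS: eventual set-level tightness of the pushed-forward
  critical SAW laws, VERBATIM the shared support item `EventualTight` (stmt-CriticalPhenomena-1372 of
  route SAWRestrictionRigidity; the `∃ δ₀` repair of the refuted all-`δ` statement stmt-0772, which is
  NOT used).  OPEN: no annulus-crossing / no-macroscopic-oscillation bound for the `x_c`-SAW (no FKG, no
  RSW; Kemppainen–Smirnov's Condition G2 is for FKG models; only sub-ballisticity is in print).  It is
  the same input the route already buys under `LimitExists` (stmt-1371, whose registered birth line has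
  the identical stub), so it costs this route nothing new.
* `stub_powerMapSubseqCovariance` — (I) IDENTIFICATION OF THE RELATION (NEW, load-bearing): for
  `D ⋐ S`, `D' = Φ(D)` with image marks, `Φ = z^{4/3}` on `S`, endpoint approximations of `D` and of
  `D'`, ONE mesh sequence `sₙ → 0⁺` and two probability measures `ν, ν'` that are the weak limits of
  the curve laws of `D` resp. `D'` along `sₙ`:  `ν' = ν.map (CurveClass.map Φ)`.  This is where a
  comparison mechanism between the `x_c`-SAW on `δℤ² ∩ D'` and on the bent graph `Φ(δℤ² ∩ D)` (the
  opened cube-corner lattice) must enter; it is a CONSEQUENCE of the crux (limits of the two sides of a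
  difference tending to `0`; `Measure.ext_of_forall_integral_eq`), hence exactly as safe as the crux,
  and it does not imply the crux without (T) (without precompactness the difference of two
  non-convergent bounded sequences need not tend to `0` even if all subsequential limits match
  vacuously) — the crux's own why-might-fail ("the difference need not converge") is precisely the
  seam between (T) and (I).

`PowerMapUniversality_of (hT : Registered.stub_eventualTight)
(hI : Registered.stub_powerMapSubseqCovariance) : …SAWConePseudogroup.PowerMapUniversality` is PROVED
below (no `sorry`; the `Registered.stub_*` abbrevs are the stub statements keyed by stub name, the
skeleton-check convention): `Filter.tendsto_of_subseq_tendsto`; Prokhorov past the junk meshes twice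
(`exists_subseqLimit`, proved here from `IsTightAlongMesh.exists_subseq` and the tree lemma
`SubseqIdentification.Negative.eventually_isProbabilityMeasure_law`, as in the `LimitExists` birth
line); (I) on the common subsequence; the continuous-mapping step `f ↦ f ∘ CurveClass.map Φ`
(`CurveClass.continuous_map`, `BoundedContinuousFunction.compContinuous`, `integral_map`).

Sorries: exactly 2 = the two `stub_*`; zero elsewhere.  Disproof used: none — this crux has no
`Disproof.lean` / `_false_without_` theorem / Negative lemma yet (`ledger crux ls
stmt-CriticalPhenomena-7303`: no workfiles before this one).  Negatives index (11 entries,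
2026-08-17) honoured: stmt-0772 (all-`δ` `IsTightLaws` tightness of the `δℤ²` SAW, refuted by far-away
coincident endpoints at `δ ∈ (1/2, 1]`) — (T) is the eventual `∃ δ₀` form, which the witness does not
touch; no other entry is a tightness / subsequential-limit statement.  BC3 probes (planner folder
`bc/probe_*.lean`): for each stub, `stub → PowerMapUniversality` and `stub → SAWScalingLimit` by
`first | exact? | simpa | aesop` FAIL.
-/

noncomputable section

open MeasureTheory Filter Topology Set Function
open Literature.Probability.RandomPlanarGeometry Literature.Probability.RandomPlanarGeometry.SAW
open Literature.Probability.LatticeModels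
open scoped ENNReal NNReal BoundedContinuousFunction Topology

namespace Summit.CriticalPhenomena.SAWScalingLimit.Cruxes.PowerMapUniversality.Birth

open Summit.CriticalPhenomena.SAWScalingLimit.Theorems.SubseqIdentification.Negative
  (eventually_isProbabilityMeasure_law)

/-! ## The registered stubs (the ONLY `sorry`s of this file) -/

/-- **stub (T) — EVENTUAL TIGHTNESS** (verbatim the shared support item `EventualTight`,
stmt-CriticalPhenomena-1372): for every Dobrushin domain and endpoint approximation there is `δ₀ > 0`
such that the pushed-forward critical SAW laws for `δ ∈ (0, δ₀]` form a tight set of measures on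
`CurveClass ℂ`.  OPEN: needs an annulus-crossing / no-macroscopic-oscillation bound for the critical
SAW (Aizenman–Burchard regularity `isTightMeasureSet_of_traversalBounds`; Kemppainen–Smirnov Condition
G2 is for FKG models).  Sources: KemppainenSmirnov2017 Thm 1.5, AizenmanBurchardDuke1999 Thm 1.1,
DuminilCopinHammond2013, LawlerSchrammWerner2004SAW §3.4.2. -/
theorem stub_eventualTight : ∀ (D : Literature.Probability.RandomPlanarGeometry.DobrushinDomain) (a b : ℝ → Literature.Probability.LatticeModels.Site 2), Literature.Probability.RandomPlanarGeometry.SAW.IsEndpointApprox D a b → ∃ δ₀ : ℝ, 0 < δ₀ ∧ MeasureTheory.IsTightMeasureSet ((fun δ => (Literature.Probability.RandomPlanarGeometry.SAW.law D.carrier δ (a δ) (b δ)).map (fun γ => γ.curve)) '' Set.Ioc 0 δ₀) := by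
  sorry

/-- **stub (I) — POWER-MAP COVARIANCE OF JOINT SUBSEQUENTIAL LIMITS** (new; the load-bearing stub):
for `D ⋐ S = {z ≠ 0, |arg z| < 3π/4}`, `D'` with carrier `Φ(D)` and marks `Φ(a)`, `Φ(b)`, a continuous
`Φ = z^{4/3}` on `S`, endpoint approximations `(a, b)` of `D` and `(a', b')` of `D'`, one mesh sequence
`sₙ → 0⁺` and two probability measures `ν`, `ν'` on `CurveClass ℂ` that are the weak limits (bounded
continuous test functions of `γ.curve`) of the critical SAW laws of `D` resp. `D'` along `sₙ`:
`ν' = ν.map (CurveClass.map Φ)`.  The subsequential shadow of the crux (a consequence of it), and the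
place where the two locally-`ℤ²` graphs `δℤ² ∩ D'` and `Φ(δℤ² ∩ D)` must be compared.  OPEN (it is
`z^{4/3}`-covariance of every joint subsequential scaling limit; false iff some pair of subsequential
limits is not `Φ`-related, e.g. if chordal subsequential limits were approximation-dependent).
Sources: Kennedy2004 = arXiv:math/0207231 §2.5 (the `α = 1/2` instance, numerically),
LawlerSchrammWerner2004SAW §3.4.2 and §4.1, Beffara2008Universal, DKKMO2020Rotational. -/
theorem stub_powerMapSubseqCovariance : ∀ (D D' : Literature.Probability.RandomPlanarGeometry.DobrushinDomain) (Φ : C(ℂ, ℂ)), closure D.carrier ⊆ {z : ℂ | z ≠ 0 ∧ |Complex.arg z| < 3 * Real.pi / 4} → Set.EqOn Φ (fun z : ℂ => z ^ ((4 : ℂ) / 3)) {z : ℂ | z ≠ 0 ∧ |Complex.arg z| < 3 * Real.pi / 4} → D'.carrier = Φ '' D.carrier → D'.pt 0 = Φ (D.pt 0) → D'.pt 1 = Φ (D.pt 1) → ∀ (a b a' b' : ℝ → Literature.Probability.LatticeModels.Site 2), Literature.Probability.RandomPlanarGeometry.SAW.IsEndpointApprox D a b → Literature.Probability.RandomPlanarGeometry.SAW.IsEndpointApprox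 D' a' b' → ∀ (s : ℕ → ℝ) (ν ν' : MeasureTheory.Measure (Literature.Probability.RandomPlanarGeometry.CurveClass ℂ)), Filter.Tendsto s Filter.atTop (nhdsWithin 0 (Set.Ioi 0)) → MeasureTheory.IsProbabilityMeasure ν → MeasureTheory.IsProbabilityMeasure ν' → (∀ f : BoundedContinuousFunction (Literature.Probability.RandomPlanarGeometry.CurveClass ℂ) ℝ, Filter.Tendsto (fun n => ∫ γ, f γ.curve ∂(Literature.Probability.RandomPlanarGeometry.SAW.law D.carrier (s n) (a (s n)) (b (s n)))) Filter.atTop (nhds (∫ x, f x ∂ν))) → (∀ f : BoundedContinuousFunction (Literature.Probability.RandomPlanarGeometry.CurveClass ℂ) ℝ, Filter.Tendsto (fun n => ∫ γ, f γ.curve ∂(Literature.Probability.RandomPlanarGeometry.SAW.law D'.carrier (s n) (a' (s n)) (b' (s n)))) Filter.atTop (nhds (∫ x, f x ∂ν'))) → ν' = ν.map (Literature.Probability.RandomPlanarGeometry.CurveClass.map Φ) := by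
  sorry

/-! ## Name-keyed aliases of the stub statements (skeleton-check convention: the hypotheses of
`PowerMapUniversality_of` are exactly the declared stubs, each BY NAME; each alias is the stub's
statement verbatim, so `stub_… : Registered.stub_…` holds by `Iff.rfl`/definitional unfolding) -/

namespace Registered

/-- Alias keyed by the stub name: the statement of `stub_eventualTight` (= item stmt-1372 `EventualTight`). -/
abbrev stub_eventualTight : Prop :=
  ∀ (D : Literature.Probability.RandomPlanarGeometry.DobrushinDomain) (a b : ℝ → Literature.Probability.LatticeModels.Site 2), Literature.Probability.RandomPlanarGeometry.SAW.IsEndpointApprox D a b → ∃ δ₀ : ℝ, 0 < δ₀ ∧ MeasureTheory.IsTightMeasureSet ((fun δ => (Literature.Probability.RandomPlanarGeometry.SAW.law D.carrier δ (a δ) (b δ)).map (fun γ => γ.curve)) '' Set.Ioc 0 δ₀)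

/-- Alias keyed by the stub name: the statement of `stub_powerMapSubseqCovariance` (new). -/
abbrev stub_powerMapSubseqCovariance : Prop :=
  ∀ (D D' : Literature.Probability.RandomPlanarGeometry.DobrushinDomain) (Φ : C(ℂ, ℂ)), closure D.carrier ⊆ {z : ℂ | z ≠ 0 ∧ |Complex.arg z| < 3 * Real.pi / 4} → Set.EqOn Φ (fun z : ℂ => z ^ ((4 : ℂ) / 3)) {z : ℂ | z ≠ 0 ∧ |Complex.arg z| < 3 * Real.pi / 4} → D'.carrier = Φ '' D.carrier → D'.pt 0 = Φ (D.pt 0) → D'.pt 1 = Φ (D.pt 1) → ∀ (a b a' b' : ℝ → Literature.Probability.LatticeModels.Site 2), Literature.Probability.RandomPlanarGeometry.SAW.IsEndpointApprox D a b → Literature.Probability.RandomPlanarGeometry.SAW.IsEndpointApprox D' a' b' → ∀ (s : ℕ → ℝ) (ν ν' : MeasureTheory.Measure (Literature.Probability.RandomPlanarGeometry.CurveClass ℂ)), Filter.Tendsto s Filter.atTop (nhdsWithin 0 (Set.Ioi 0)) → MeasureTheory.IsProbabilityMeasure ν → MeasureTheory.IsProbabilityMeasure ν' → (∀ f : BoundedContinuousFunction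 (Literature.Probability.RandomPlanarGeometry.CurveClass ℂ) ℝ, Filter.Tendsto (fun n => ∫ γ, f γ.curve ∂(Literature.Probability.RandomPlanarGeometry.SAW.law D.carrier (s n) (a (s n)) (b (s n)))) Filter.atTop (nhds (∫ x, f x ∂ν))) → (∀ f : BoundedContinuousFunction (Literature.Probability.RandomPlanarGeometry.CurveClass ℂ) ℝ, Filter.Tendsto (fun n => ∫ γ, f γ.curve ∂(Literature.Probability.RandomPlanarGeometry.SAW.law D'.carrier (s n) (a' (s n)) (b' (s n)))) Filter.atTop (nhds (∫ x, f x ∂ν'))) → ν' = ν.map (Literature.Probability.RandomPlanarGeometry.CurveClass.map Φ)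

end Registered

/-! ## Proved glue: Prokhorov past the junk meshes -/

/-- **Subsequential limits exist under eventual tightness.**  If the pushed-forward critical SAW laws
are a tight set for `δ ∈ (0, δ₀]`, then along every mesh sequence `sₙ → 0⁺` some subsequence converges
weakly (bounded continuous test functions of `γ.curve`) to a probability measure.  The SAW law is a
probability measure only for small `δ` (junk value `0` when `a_δ, b_δ` are not joined), so Prokhorov
(`IsTightAlongMesh.exists_subseq`) is run on the surrogate family "push-forward law if it is a
probability measure, else a Dirac mass", which agrees with the push-forward laws on a germ at `0⁺`
(`eventually_isProbabilityMeasure_law`).  Same argument as `Cruxes/LimitExists/Lines/birth.lean`.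
[cite: BillingsleyCPM1999, Thm. 5.1] -/
theorem exists_subseqLimit {D : DobrushinDomain} {a b : ℝ → Site 2} (hab : SAW.IsEndpointApprox D a b)
    {δ₀ : ℝ} (hδ₀ : 0 < δ₀)
    (htight : IsTightMeasureSet ((fun δ => (SAW.law D.carrier δ (a δ) (b δ)).map
      (fun γ => γ.curve)) '' Set.Ioc 0 δ₀))
    {s : ℕ → ℝ} (hs : Tendsto s atTop (𝓝[>] (0 : ℝ))) :
    ∃ (φ : ℕ → ℕ) (ν : Measure (CurveClass ℂ)), StrictMono φ ∧ IsProbabilityMeasure ν ∧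
      ∀ f : CurveClass ℂ →ᵇ ℝ, Tendsto (fun n => ∫ γ, f γ.curve
        ∂(SAW.law D.carrier (s (φ n)) (a (s (φ n))) (b (s (φ n))))) atTop (𝓝 (∫ x, f x ∂ν)) := by
  classical
  -- the push-forward laws and the surrogate family of probability laws on the curve space
  obtain ⟨L, hL⟩ : ∃ L : ℝ → Measure (CurveClass ℂ), ∀ δ, L δ =
      (SAW.law D.carrier δ (a δ) (b δ)).map (fun γ => γ.curve) := ⟨_, fun _ => rfl⟩
  obtain ⟨μ, hμ⟩ : ∃ μ : ℝ → Measure (CurveClass ℂ), ∀ δ, μ δ =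
      if IsProbabilityMeasure (L δ) then L δ
      else Measure.dirac (CurveClass.mk (Curve.const 0)) := ⟨_, fun _ => rfl⟩
  have hμprob : ∀ δ, IsProbabilityMeasure (μ δ) := by
    intro δ
    by_cases h : IsProbabilityMeasure (L δ)
    · rw [hμ δ, if_pos h]; exact h
    · rw [hμ δ, if_neg h]; infer_instance
  -- for all small `δ` the surrogate IS the push-forward law
  have hev : ∀ᶠ δ in 𝓝[>] (0 : ℝ), μ δ = L δ := by
    filter_upwards [eventually_isProbabilityMeasure_law hab] with δ hδ
    haveI := hδ
    have hp : IsProbabilityMeasure (L δ) := by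
      rw [hL δ]
      exact Measure.isProbabilityMeasure_map (SAW.aemeasurable_curve _ _ _ _)
    rw [hμ δ, if_pos hp]
  -- tightness along the mesh of the surrogate family, observed through the identity
  have hT : IsTightAlongMesh (Ωδ := fun _ : ℝ => CurveClass ℂ)
      (fun (_ : ℝ) (x : CurveClass ℂ) => x) μ := by
    intro ε hε
    obtain ⟨K, hK, hbK⟩ :=
      (isTightMeasureSet_iff_exists_isCompact_measure_compl_le.1 htight) ε hε
    refine ⟨K, hK, ?_⟩
    filter_upwards [hev, Ioc_mem_nhdsGT hδ₀] with δ hδ hδI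
    show μ δ Kᶜ ≤ ε
    rw [hδ, hL δ]
    exact hbK _ ⟨δ, hδI, rfl⟩
  haveI : ∀ δ, IsProbabilityMeasure (μ δ) := hμprob
  obtain ⟨φ, ν, hφ, hν, hlim⟩ :=
    hT.exists_subseq (Filter.Eventually.of_forall fun δ => aemeasurable_id') hs
  refine ⟨φ, ν, hφ, hν, fun f => ?_⟩
  have hs' : Tendsto (fun n => s (φ n)) atTop (𝓝[>] (0 : ℝ)) := hs.comp hφ.tendsto_atTop
  refine (hlim f).congr' ?_
  filter_upwards [hs'.eventually hev] with n hn
  have hn' : μ (s (φ n)) = L (s (φ n)) := hn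
  show ∫ x, f x ∂(μ (s (φ n))) = ∫ γ, f γ.curve ∂(SAW.law D.carrier (s (φ n)) (a (s (φ n))) (b (s (φ n))))
  rw [hn', hL]
  exact integral_map (SAW.aemeasurable_curve _ _ _ _) f.continuous.aestronglyMeasurable

/-! ## The composition: the crux BY NAME from the two stubs -/

/-- **`PowerMapUniversality` from (T) and (I).**  Fix the data of the crux and a bounded continuous
`f`; by the subsequence principle (`Filter.tendsto_of_subseq_tendsto`, `𝓝[>] 0` is countably
generated) it suffices to find, along every mesh sequence `sₙ → 0⁺`, a subsequence along which
`∫ f∘(map Φ) d law_D − ∫ f d law_{D'} → 0`.  Prokhorov past the junk meshes (`exists_subseqLimit`,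
from (T)) gives a subsequence with a probability weak limit `ν` of the `D`-laws, then a further one
with a probability weak limit `ν'` of the `D'`-laws; (I) on the common subsequence gives
`ν' = (map Φ)_* ν`; and since `f ∘ CurveClass.map Φ` is bounded continuous
(`CurveClass.continuous_map`), `∫ f∘(map Φ) d law_D → ∫ f∘(map Φ) dν = ∫ f dν'` (`integral_map`)
while `∫ f d law_{D'} → ∫ f dν'`, so the difference tends to `0`.
[cite: BillingsleyCPM1999, Thm. 2.6 and Thm. 5.1] -/
theorem PowerMapUniversality_of (hT : Registered.stub_eventualTight)
    (hI : Registered.stub_powerMapSubseqCovariance) :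
    Summit.CriticalPhenomena.SAWScalingLimit.Theses.SAWConePseudogroup.PowerMapUniversality := by
  intro D D' Φ hcl hEq hcar h0 h1 a b a' b' hab hab' f
  refine tendsto_of_subseq_tendsto fun s hs => ?_
  -- a probability subsequential limit `ν` of the `D`-laws along `s ∘ φ₁`
  obtain ⟨δ₀, hδ₀, htight⟩ := hT D a b hab
  obtain ⟨φ₁, ν, hφ₁, hν, hlim₁⟩ := exists_subseqLimit hab hδ₀ htight hs
  have hs₁ : Tendsto (fun n => s (φ₁ n)) atTop (𝓝[>] (0 : ℝ)) := hs.comp hφ₁.tendsto_atTop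
  -- a probability subsequential limit `ν'` of the `D'`-laws along `s ∘ φ₁ ∘ φ₂`
  obtain ⟨δ₀', hδ₀', htight'⟩ := hT D' a' b' hab'
  obtain ⟨φ₂, ν', hφ₂, hν', hlim₂⟩ := exists_subseqLimit hab' hδ₀' htight' hs₁
  have hs₂ : Tendsto (fun n => s (φ₁ (φ₂ n))) atTop (𝓝[>] (0 : ℝ)) := hs₁.comp hφ₂.tendsto_atTop
  -- the `D`-laws still converge to `ν` along the common subsequence
  have hlim₁' : ∀ g : CurveClass ℂ →ᵇ ℝ, Tendsto (fun n => ∫ γ, g γ.curve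
      ∂(SAW.law D.carrier (s (φ₁ (φ₂ n))) (a (s (φ₁ (φ₂ n)))) (b (s (φ₁ (φ₂ n)))))) atTop
      (𝓝 (∫ x, g x ∂ν)) := fun g => (hlim₁ g).comp hφ₂.tendsto_atTop
  -- (I): the two joint subsequential limits are related by the power map
  have hrel : ν' = ν.map (CurveClass.map Φ) :=
    hI D D' Φ hcl hEq hcar h0 h1 a b a' b' hab hab' (fun n => s (φ₁ (φ₂ n))) ν ν' hs₂ hν hν'
      hlim₁' hlim₂
  refine ⟨fun n => φ₁ (φ₂ n), ?_⟩
  -- the composed test function `f ∘ CurveClass.map Φ` is bounded continuous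
  set g : CurveClass ℂ →ᵇ ℝ := f.compContinuous ⟨CurveClass.map Φ, CurveClass.continuous_map Φ⟩
    with hg
  have hA : Tendsto (fun n => ∫ γ, f (CurveClass.map Φ γ.curve)
      ∂(SAW.law D.carrier (s (φ₁ (φ₂ n))) (a (s (φ₁ (φ₂ n)))) (b (s (φ₁ (φ₂ n)))))) atTop
      (𝓝 (∫ x, f x ∂ν')) := by
    have hmap : ∫ x, f x ∂ν' = ∫ x, g x ∂ν := by
      rw [hrel, integral_map (CurveClass.measurable_map Φ).aemeasurable
        f.continuous.aestronglyMeasurable]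
      simp [hg]
    rw [hmap]
    simpa [hg] using hlim₁' g
  have hB := hlim₂ f
  have h := hA.sub hB
  simpa using h

/-- Wiring check (an `example`, so that `PowerMapUniversality_of` stays the only theorem concluding
the crux): the registered (sorried) stubs feed the skeleton theorem as stated — this term becomes
the crux proof when the two `sorry`s above are discharged. -/
example : Summit.CriticalPhenomena.SAWScalingLimit.Theses.SAWConePseudogroup.PowerMapUniversality :=
  PowerMapUniversality_of stub_eventualTight stub_powerMapSubseqCovariance

/-! ## Pins (documentation) -/

/-- (T) is verbatim the shared support item `SAWRestrictionRigidity.EventualTight`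
(stmt-CriticalPhenomena-1372) — stated here against this route's import closure: the two texts are
syntactically identical, so a proof of the item closes the stub (by `Iff.rfl` once both are in scope). -/
theorem stub_eventualTight_def : Registered.stub_eventualTight ↔
    ∀ (D : DobrushinDomain) (a b : ℝ → Site 2), SAW.IsEndpointApprox D a b → ∃ δ₀ : ℝ, 0 < δ₀ ∧
      IsTightMeasureSet ((fun δ => (SAW.law D.carrier δ (a δ) (b δ)).map (fun γ => γ.curve)) ''
        Set.Ioc 0 δ₀) :=
  Iff.rfl

/-- Sanity (necessity of (I)): under the crux, every pair of joint probability subsequential limits IS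
related by the power map — so (I) is a CONSEQUENCE of `PowerMapUniversality` (nothing is lost by the
cut on the identification side; all that is added is precompactness (T)). [cite: BillingsleyCPM1999, Thm. 1.2] -/
theorem powerMapSubseqCovariance_of_powerMapUniversality
    (h : Summit.CriticalPhenomena.SAWScalingLimit.Theses.SAWConePseudogroup.PowerMapUniversality) :
    Registered.stub_powerMapSubseqCovariance := by
  intro D D' Φ hcl hEq hcar h0 h1 a b a' b' hab hab' s ν ν' hs hν hν' hlim hlim'
  haveI := hν; haveI := hν'
  haveI : IsProbabilityMeasure (ν.map (CurveClass.map Φ)) :=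
    Measure.isProbabilityMeasure_map (CurveClass.measurable_map Φ).aemeasurable
  refine ext_of_forall_integral_eq_of_IsFiniteMeasure fun f => ?_
  rw [integral_map (CurveClass.measurable_map Φ).aemeasurable f.continuous.aestronglyMeasurable]
  set g : CurveClass ℂ →ᵇ ℝ := f.compContinuous ⟨CurveClass.map Φ, CurveClass.continuous_map Φ⟩
    with hg
  -- along `s`: `∫ g d law_D → ∫ g dν`, `∫ f d law_{D'} → ∫ f dν'`, and the crux says the
  -- difference tends to `0`
  have hu : Tendsto (fun n => ∫ γ, f (CurveClass.map Φ γ.curve)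
      ∂(SAW.law D.carrier (s n) (a (s n)) (b (s n)))) atTop (𝓝 (∫ x, g x ∂ν)) := by
    simpa [hg] using hlim g
  have hv := hlim' f
  have huv : Tendsto (fun n => (∫ γ, f (CurveClass.map Φ γ.curve)
      ∂(SAW.law D.carrier (s n) (a (s n)) (b (s n)))) -
      ∫ γ, f γ.curve ∂(SAW.law D'.carrier (s n) (a' (s n)) (b' (s n)))) atTop (𝓝 0) :=
    (h D D' Φ hcl hEq hcar h0 h1 a b a' b' hab hab' f).comp hs
  have hlimsub : Tendsto (fun n => (∫ γ, f (CurveClass.map Φ γ.curve)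
      ∂(SAW.law D.carrier (s n) (a (s n)) (b (s n)))) -
      ∫ γ, f γ.curve ∂(SAW.law D'.carrier (s n) (a' (s n)) (b' (s n)))) atTop
      (𝓝 (∫ x, g x ∂ν - ∫ x, f x ∂ν')) := hu.sub hv
  have hzero : ∫ x, g x ∂ν - ∫ x, f x ∂ν' = 0 := tendsto_nhds_unique hlimsub huv
  have : ∫ x, g x ∂ν = ∫ x, f x ∂ν' := sub_eq_zero.1 hzero
  simpa [hg] using this.symm

end Summit.CriticalPhenomena.SAWScalingLimit.Cruxes.PowerMapUniversality.Birth

end
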